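import Literature.Computability.AlgebraicComplexity.GKSS19PartialHomogenisation
import Literature.Computability.AlgebraicComplexity.SparseCircuitBounds
import HarnessLib

/-!
# Guo–Kumar–Saptharishi–Solomon 2019, §3 "Obtaining a circuit for `P`": gate-list bookkeeping
# tools for the reconstruction (availability of homogeneous data, linear combinations, grafts)

Cell `val-lit`, seat t19 (literature-prover); groundwork for the discharge programme of
`GKSS2019_mainThm` (v2, erratum A34) along the printed proof of [GKSS19, §3]. THEOREM-ONLY (no
definitions, no named facts); nothing here bears on `VP ≠ VNP`, which is NOT proved.

Source: Z. Guo, M. Kumar, R. Saptharishi, N. Solomon, *Derandomization from algebraic hardness*,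
SIAM J. Comput. 51 (2022) = arXiv:1905.00091 [GuoKumarSaptharishiSolomon2019], §3 "Obtaining a
circuit for `P`" (held text `paper:arxiv-1905.00091`, p0012.txt:L5–L28: "we now describe how to
obtain a circuit computing `P` with the above inductive construction. At each inductive step …
`size(C_{j+1}) ≤ size(C_j) + poly(s', d, D')` … The final circuit `C_{d-n}` has size
`poly(s, d, D, n^k)`") in the tree's shared-gate-list formalism of
`HrubesSensitiveMonotoneProofs.lean` (`Hrubes2020.avail_*`, `extend_*`) and
`HomogeneousComponentsComplexity.lean` / `AC/GKSS19PartialHomogenisation.lean` (`hc_*`).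

## What is here

* `hc_of_isHomogeneous_avail` — an available HOMOGENEOUS value has all its homogeneous components
  available (they are itself or `0`); `avail_of_hc_isHomogeneous` — and conversely;
* `hc_graft_complexity'` — `AC/GKSS19PartialHomogenisation.hc_graft_complexity` for a finite
  index type of inputs (the reconstruction indexes its carried quantities by pairs (level,
  exponent));
* `avail_linearCombination` — `Σ_{t ∈ T} C(β_t) · v_t` of available values is available after
  `2·|T|` more plain gates;
* `complexity_le_length_of_avail` — an available value has complexity at most the length of the
  gate list (the final read-off "The final circuit … has size …").

## References
* [GuoKumarSaptharishiSolomon2019] arXiv:1905.00091, §3 (p0012.txt:L5–28).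
* [Burgisser2000] Def. 2.1 / Rem. 2.7 (tree `ArithCircuit`, `complexity_le_size`).
-/

noncomputable section

namespace Literature.Computability.AlgebraicComplexity

open MvPolynomial Literature.Barriers.ValiantsHypothesis

universe u v

namespace ArithCircuit

namespace Homogenisation

variable {k : Type u} [CommSemiring k] {σ : Type v}

/-- An available homogeneous value has all its homogeneous components (itself or `0`) available.
[cite: GuoKumarSaptharishiSolomon2019, §3 (arXiv p0012.txt:L5-20), "each co-ordinate of `R` … homogeneous components"] -/
theorem hc_of_isHomogeneous_avail (gs : List (Gate k σ)) (d : ℕ) {v : MvPolynomial σ k} {δ : ℕ}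
    (hv : v.IsHomogeneous δ)
    (ha : ∃ u : Operand k σ, u.RefsBelow gs.length ∧ u.eval (gateValues gs) = v) :
    ∀ e ≤ d, ∃ u : Operand k σ, u.RefsBelow gs.length ∧
      u.eval (gateValues gs) = homogeneousComponent e v := by
  intro e _
  rw [homogeneousComponent_of_mem hv]
  split_ifs
  · exact ha
  · simpa using Hrubes2020.avail_C gs (0 : k)

/-- Conversely, a homogeneous value of degree `δ ≤ d` whose components of degree `≤ d` are
available is available. [cite: GuoKumarSaptharishiSolomon2019, §3 (arXiv p0012.txt:L5-20)] -/
theorem avail_of_hc_isHomogeneous (gs : List (Gate k σ)) {d : ℕ} {v : MvPolynomial σ k} {δ : ℕ}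
    (hv : v.IsHomogeneous δ) (hδ : δ ≤ d)
    (h : ∀ e ≤ d, ∃ u : Operand k σ, u.RefsBelow gs.length ∧
      u.eval (gateValues gs) = homogeneousComponent e v) :
    ∃ u : Operand k σ, u.RefsBelow gs.length ∧ u.eval (gateValues gs) = v := by
  have := h δ hδ
  rwa [homogeneousComponent_of_mem hv, if_pos rfl] at this

/-- **Lemma 20 with a finite index type of inputs** (`hc_graft_complexity` transported along
`Fintype.equivFin`). [cite: GuoKumarSaptharishiSolomon2019, Lemma 20 (arXiv p0010.txt:L24-37)] -/
theorem hc_graft_complexity' {ι : Type*} [Fintype ι] [DecidableEq ι] {gs : List (Gate k σ)}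
    (hgs : ∀ g ∈ gs, g.fanIn ≤ 2 ∧ IsPlainGate g) {d : ℕ} (h : ι → MvPolynomial σ k)
    (hin : ∀ i, ∀ e ≤ d, ∃ u : Operand k σ, u.RefsBelow gs.length ∧
      u.eval (gateValues gs) = homogeneousComponent e (h i))
    (f : MvPolynomial ι k) :
    ∃ gs' : List (Gate k σ), gs <+: gs' ∧ (∀ g ∈ gs', g.fanIn ≤ 2 ∧ IsPlainGate g) ∧
      gs'.length ≤ gs.length + (d + 2) ^ 2 * complexity f ∧
      ∀ e ≤ d, ∃ u : Operand k σ, u.RefsBelow gs'.length ∧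
        u.eval (gateValues gs') = homogeneousComponent e (aeval h f) := by
  classical
  set eqv := Fintype.equivFin ι with heqv
  obtain ⟨gs', hp, hg, hl, hr⟩ := hc_graft_complexity hgs (h ∘ eqv.symm)
    (fun i => hin (eqv.symm i)) (MvPolynomial.rename eqv f)
  refine ⟨gs', hp, hg, hl.trans (Nat.add_le_add_left (Nat.mul_le_mul_left _
    (complexity_rename_le_holds' _ f)) _), ?_⟩
  have hev : aeval (h ∘ eqv.symm) (MvPolynomial.rename eqv f) = aeval h f := by
    rw [MvPolynomial.aeval_rename]
    have : ((h ∘ eqv.symm) ∘ eqv : ι → MvPolynomial σ k) = h := by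
      funext i
      simp
    rw [this]
  rw [hev] at hr
  exact hr

end Homogenisation

end ArithCircuit

namespace Hrubes2020

open ArithCircuit

variable {k : Type u} [CommSemiring k] {σ : Type v}

/-- **Linear combinations of available values are cheap**: `Σ_{t ∈ T} C(β_t) · v_t` is available
after at most `2·|T|` more plain fan-in-two gates (one scalar product and one addition per
term; the print's "linear combination of its evaluations on this set").
[cite: GuoKumarSaptharishiSolomon2019, §3 (arXiv p0011.txt:L84-88, p0012.txt:L5-20)] -/
theorem avail_linearCombination {ι : Type*} [DecidableEq ι] (T : Finset ι) (β : ι → k)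
    (v : ι → MvPolynomial σ k) {gs : List (Gate k σ)} (hgs : ∀ g ∈ gs, g.fanIn ≤ 2 ∧ IsPlainGate g)
    (hv : ∀ t ∈ T, ∃ u : Operand k σ, u.RefsBelow gs.length ∧ u.eval (gateValues gs) = v t) :
    ∃ gs' : List (Gate k σ), gs <+: gs' ∧ (∀ g ∈ gs', g.fanIn ≤ 2 ∧ IsPlainGate g) ∧
      gs'.length ≤ gs.length + 2 * T.card ∧
      ∃ u : Operand k σ, u.RefsBelow gs'.length ∧
        u.eval (gateValues gs') = ∑ t ∈ T, C (β t) * v t := by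
  induction T using Finset.induction_on with
  | empty =>
    exact ⟨gs, List.prefix_rfl, hgs, by simp, by simpa using avail_C gs (0 : k)⟩
  | insert a T ha ih =>
    obtain ⟨gs₁, hp₁, hg₁, hl₁, hu₁⟩ := ih (fun t ht => hv t (Finset.mem_insert_of_mem ht))
    obtain ⟨gs₂, hp₂, hg₂, hl₂, hu₂⟩ :=
      extend_smul (β a) hg₁ (avail_mono hp₁ (hv a (Finset.mem_insert_self a T)))
    obtain ⟨gs₃, hp₃, hg₃, hl₃, hu₃⟩ := extend_add hg₂ hu₂ (avail_mono hp₂ hu₁)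
    refine ⟨gs₃, (hp₁.trans hp₂).trans hp₃, hg₃, ?_, ?_⟩
    · rw [Finset.card_insert_of_notMem ha]; omega
    · rw [Finset.sum_insert ha]; exact hu₃

/-- **Read-off**: a value available in a plain fan-in-two gate list has complexity at most the
length of the list ("The final circuit `C_{d-n}` … has size …").
[cite: GuoKumarSaptharishiSolomon2019, §3 (arXiv p0012.txt:L22-28)] -/
theorem complexity_le_length_of_avail {gs : List (Gate k σ)}
    (hgs : ∀ g ∈ gs, g.fanIn ≤ 2 ∧ IsPlainGate g) {v : MvPolynomial σ k}
    (hv : ∃ u : Operand k σ, u.RefsBelow gs.length ∧ u.eval (gateValues gs) = v) :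
    complexity v ≤ gs.length := by
  obtain ⟨u, -, hu⟩ := hv
  have hc : (⟨gs, u⟩ : ArithCircuit k σ).Computes v := hu
  exact ArithCircuit.complexity_le_size (P := ⟨gs, u⟩) (fun g hg => (hgs g hg).1) hc

end Hrubes2020

end Literature.Computability.AlgebraicComplexity
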